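import Literature.AlgebraicGeometry.Resolution.RegularQuotientIdeal
import Mathlib.RingTheory.Localization.AtPrime.Basic
import HarnessLib

/-!
# Symbolic powers of primes with regular quotient: `P⁽ⁿ⁾ = Pⁿ ⊆ 𝔪ⁿ` (order does not drop under generisation at regular points)

Topic: `Literature/AlgebraicGeometry/Resolution`. A brick for the upper semicontinuity of the
order `x ↦ ord_x J` on a regular scheme ([CoP1] = Cossart–Piltant, J. Algebra 320 (2008),
proof of Prop. 4.2: "`Σ := {x ∈ X | m(x) = μ}` … `Σ` is a closed subset of `X`"): along a
specialisation `ζ ⤳ x` of a REGULAR scheme the order can only go up, `ord_x J ≥ ord_ζ J`, which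
in the local ring `R = 𝒪_{X,x}` with `P` the prime of `ζ` reads `J R_P ⊆ Pⁿ R_P ⇒ J ⊆ 𝔪ⁿ`, i.e.
`P⁽ⁿ⁾ ⊆ 𝔪ⁿ` for the symbolic powers. This file PROVES it at the points where the closed
subscheme `V(P)` is itself regular (`R/P` a regular local ring) — the terminal case of the
general statement, which is reached after embedded resolution of the curve `V(P)`; at such
points `P` is generated by a quasi-regular `R`-sequence (part of a regular system of
parameters, Matsumura Thm. 14.2: `RegularQuotientIdeal.lean`), so its powers are `P`-primary
(Matsumura Thm. 16.2 (ii): `QuasiRegularSequences.lean`):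

* `mem_pow_of_mul_mem_pow_of_isRegularLocalRing_quotient` — `a ∉ P`, `a y ∈ Pⁿ ⇒ y ∈ Pⁿ`;
* `comap_map_pow_eq_pow_of_isRegularLocalRing_quotient` — **`P⁽ⁿ⁾ = Pⁿ R_P ∩ R = Pⁿ`** (for
  any localisation `S` of `R` at `P`);
* `le_maximalIdeal_pow_of_map_le_of_isRegularLocalRing_quotient` — **`J R_P ⊆ (P R_P)ⁿ ⇒
  J ⊆ 𝔪ⁿ`**: the order of an ideal at the closed point is at least its order at a
  generisation with regular closure (the "easy direction" of Zariski–Nagata /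
  Eisenbud–Hochster: `P⁽ⁿ⁾ ⊆ 𝔪ⁿ` where `R/P` is regular).

## Sources

* V. Cossart, O. Piltant, J. Algebra 320 (2008), proof of Prop. 4.2 (PDF p. 7) — application.
  [CossartPiltant2008]
* H. Matsumura, *Commutative Ring Theory* (1986), Thm. 14.2, Thm. 16.2 (ii). [Matsumura1987]
* D. Eisenbud, M. Hochster, *A Nullstellensatz with nilpotents and Zariski's Main Lemma on
  holomorphic functions*, J. Algebra 58 (1979) — background (the regular-point inclusion).
-/

noncomputable section

namespace Literature.AlgebraicGeometry.Resolution

universe u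

open IsLocalRing

variable {R : Type u} [CommRing R] [IsRegularLocalRing R]

/-- **Powers of a prime with regular quotient are primary** (Matsumura Thm. 14.2 + 16.2 (ii)):
if `R` is a regular local ring, `P` a prime ideal with `R/P` regular, `a ∉ P` and `a y ∈ Pⁿ`,
then `y ∈ Pⁿ`. [cite: Matsumura1987, Thm. 16.2 (ii)] -/
theorem mem_pow_of_mul_mem_pow_of_isRegularLocalRing_quotient {P : Ideal R} [P.IsPrime]
    [IsRegularLocalRing (R ⧸ P)] {a : R} (ha : a ∉ P) (n : ℕ) {y : R} (h : a * y ∈ P ^ n) :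
    y ∈ P ^ n := by
  have hP : P ≤ maximalIdeal R := IsLocalRing.le_maximalIdeal (Ideal.IsPrime.ne_top ‹_›)
  obtain ⟨c, f, -, hspan, hq, -⟩ :=
    exists_isQuasiRegular_span_eq_of_isRegularLocalRing_quotient hP (P : Set R) (Ideal.span_eq P)
  rw [← hspan] at ha h ⊢
  refine hq.mem_pow_of_mul_mem_pow (fun z hz => ?_) n h
  exact ((Ideal.IsPrime.mem_or_mem (hspan ▸ ‹P.IsPrime›) hz).resolve_left ha)

/-- **`P⁽ⁿ⁾ = Pⁿ`**: the contraction of `Pⁿ S` from a localisation `S = R_P` is `Pⁿ`, for a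
prime `P` of a regular local ring with `R/P` regular. [cite: Matsumura1987, Thm. 16.2 (ii)] -/
theorem comap_map_pow_eq_pow_of_isRegularLocalRing_quotient (P : Ideal R) [P.IsPrime]
    [IsRegularLocalRing (R ⧸ P)] (S : Type*) [CommRing S] [Algebra R S]
    [IsLocalization.AtPrime S P] (n : ℕ) :
    ((P ^ n).map (algebraMap R S)).comap (algebraMap R S) = P ^ n := by
  refine le_antisymm (fun y hy => ?_) Ideal.le_comap_map
  rw [Ideal.mem_comap, IsLocalization.mem_map_algebraMap_iff P.primeCompl S] at hy
  obtain ⟨⟨⟨b, hb⟩, s⟩, hs⟩ := hy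
  simp only at hs
  obtain ⟨c, hc⟩ := (IsLocalization.eq_iff_exists P.primeCompl S).mp
    (show algebraMap R S (y * s) = algebraMap R S b by rw [map_mul, hs])
  -- `(c s) y = c b ∈ Pⁿ` with `c s ∉ P`
  have hcs : (c : R) * s ∉ P := fun h' => (Ideal.IsPrime.mem_or_mem ‹_› h').elim
    (Ideal.mem_primeCompl_iff.mp c.2) (Ideal.mem_primeCompl_iff.mp s.2)
  refine mem_pow_of_mul_mem_pow_of_isRegularLocalRing_quotient hcs n ?_
  rw [show (c : R) * s * y = c * (y * s) by ring, hc]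
  exact Ideal.mul_mem_left _ _ hb

/-- **`J R_P ⊆ (P R_P)ⁿ ⇒ J ⊆ Pⁿ ⊆ 𝔪ⁿ`** for a prime `P` of a regular local ring with `R/P`
regular: the order of an ideal at the closed point is at least its order at such a
generisation ([CoP1], proof of Prop. 4.2: closedness of `Σ`, at the regular points of the
curves involved). [cite: CossartPiltant2008, proof of Prop. 4.2] -/
theorem le_maximalIdeal_pow_of_map_le_of_isRegularLocalRing_quotient (P : Ideal R) [P.IsPrime]
    [IsRegularLocalRing (R ⧸ P)] (S : Type*) [CommRing S] [Algebra R S]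
    [IsLocalization.AtPrime S P] [IsLocalRing S] {J : Ideal R} {n : ℕ}
    (hJ : J.map (algebraMap R S) ≤ maximalIdeal S ^ n) : J ≤ maximalIdeal R ^ n := by
  have hP : P ≤ maximalIdeal R := IsLocalRing.le_maximalIdeal (Ideal.IsPrime.ne_top ‹_›)
  have h1 : J ≤ P ^ n := by
    rw [← comap_map_pow_eq_pow_of_isRegularLocalRing_quotient P S n, ← Ideal.map_le_iff_le_comap,
      Ideal.map_pow, IsLocalization.AtPrime.map_eq_maximalIdeal P S]
    exact hJ
  exact h1.trans (Ideal.pow_right_mono hP n)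

end Literature.AlgebraicGeometry.Resolution

end
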